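import Mathlib
import HarnessLib
import Summits.ValiantsHypothesis.ValiantsHypothesis.Theorems.LacunarySymmetroidMatrixDescartesProductPlusOneSeparatingWeightWindow
import Summits.ValiantsHypothesis.ValiantsHypothesis.Theorems.LacunarySymmetroidMatrixDescartesProductPlusOneSeparatingWeightOneSignedK

/-!
# ValiantsHypothesis / LacunarySymmetroid — crux `MatrixDescartes` (stmt-ValiantsHypothesis-18050, V1),
# LINE (A) «product_plus_one»: the mean-pivot WINDOW law in line currency and the mean-ordered WINDOW law, EVERY `K`

Window companions (via ✓ `sepWeight_window_le_one`) of the global every-`K` laws ✓ `sepWeight_meanPivot_eulerNumerator_le` /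
✓ `sepWeight_meanOrdered_mixedK_le`, in the shape the floor's interval-by-interval bookkeeping consumes (`#{roots in [u,v]} ≤ 1`):

* ★ `sepWeight_meanPivot_window_le_one` — every format, uniform shift `c` (`ν = m·c`): a pivot at every zero in a pole-free window
  `[u,v] ⊂ (0,∞)` ⇒ at most one zero there;
* ★★ `sepWeight_meanPivot_eulerNumerator_window_le_one` — LINE CURRENCY, every `(m, K)`, every support, every coupling `l₀`: on a pole-free
  window, a pivot `μ` with `f_j·(B⁽²⁾_j − μB_j) ≤ 0`, `B_j ≠ 0` at every zero ⇒ `eulerNumerator d a l₀` has at most ONE root in `[u,v]`;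
* ★★★ `sepWeight_meanOrdered_window_le_one` — EVERY `K`, bottom coupling, rows upper-signed or one-signed: on a pole-free window on which,
  pointwise, every one-signed row and every switched upper-signed row has tilted gap-mean at most that of every unswitched upper-signed row,
  `eulerNumerator d a l₀` has at most ONE root — the every-`K` ordered-window law (K = 3: ✓ `sepWeight_orderedWindow_le_one`).

HONEST FRAMING: window cells for the research stubs `stub_oneChangeFloorK3` / `stub_polyLaw`; NOT those stubs, not `MatrixDescartes`;
`VP ≠ VNP` is NOT proved.  No definitions, no named facts, no sorry.
-/

set_option linter.dupNamespace false

namespace Summit.ValiantsHypothesis.ValiantsHypothesis.Theorems.LacunarySymmetroidMatrixDescartes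

namespace ProductPlusOne

open Polynomial Finset
open scoped BigOperators

/-- ★ **MEAN-PIVOT WINDOW LAW** (every format, uniform shift `c`, level `ν = m·c`): on a pole-free window `[u,v] ⊂ (0,∞)`, if at every
zero `t` of `E` in the window some pivot `μ` has `f_j(t)·(θ_c²f_j(t) − μ θ_c f_j(t)) ≤ 0` and `θ_c f_j(t) ≠ 0` for every row, then `E` has at
most one zero in `[u,v]`. [this file's theorem] -/
theorem sepWeight_meanPivot_window_le_one {m : ℕ} (f : Fin m → ℝ[X]) (c : ℝ) {u v : ℝ} (hu : 0 < u)
    (hP : ∀ t ∈ Set.Icc u v, (∏ j, f j).eval t ≠ 0)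
    (hpiv : ∀ t ∈ Set.Icc u v, (X * derivative (∏ j, f j) - C ((m : ℝ) * c) * ∏ j, f j).eval t = 0 →
      ∃ μ : ℝ, ∀ j, (f j).eval t * (((X * derivative (X * derivative (f j))).eval t - 2 * c * (X * derivative (f j)).eval t + c ^ 2 * (f j).eval t) - μ * ((X * derivative (f j)).eval t - c * (f j).eval t)) ≤ 0 ∧ (X * derivative (f j)).eval t - c * (f j).eval t ≠ 0) :
    ((X * derivative (∏ j, f j) - C ((m : ℝ) * c) * ∏ j, f j).roots.toFinset.filter (fun t => u ≤ t ∧ t ≤ v)).card ≤ 1 := by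
  refine sepWeight_window_le_one f ((m : ℝ) * c) hu hP (fun t ht hEt => ?_)
  obtain ⟨μ, hrow⟩ := hpiv t ht hEt
  refine ⟨μ, fun _ => c, by simp, fun j => ?_⟩
  have h := sepWeight_meanPivot_row_neg (hrow j).1 (hrow j).2
  simpa only [eval_sub, eval_mul, eval_pow] using h

/-- ★★ **MEAN-PIVOT WINDOW LAW IN LINE CURRENCY** (every `(m, K)`, every support, every coupling `l₀`): on a pole-free window
`[u,v] ⊂ (0,∞)`, if at every zero `t ∈ [u,v]` of `eulerNumerator d a l₀` (unfolded) some pivot `μ` has `f_j(t)·(B⁽²⁾_j(t) − μ B_j(t)) ≤ 0` and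
`B_j(t) ≠ 0` for all rows, then there is at most ONE root in `[u,v]`. [this file's theorem] -/
theorem sepWeight_meanPivot_eulerNumerator_window_le_one {m K : ℕ} (d : Fin K → ℕ) (a : Fin m → Fin K → ℝ) (l₀ : Fin K)
    {u v : ℝ} (hu : 0 < u) (hfree : ∀ t ∈ Set.Icc u v, ∀ j, (∑ l, a j l * t ^ (d l)) ≠ 0)
    (hpiv : ∀ t ∈ Set.Icc u v, (∑ j, (∑ l, C (a j l * ((d l : ℝ) - d l₀)) * X ^ (d l)) * ∏ i ∈ Finset.univ.erase j, (∑ l, C (a i l) * X ^ (d l)) : ℝ[X]).eval t = 0 →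
      ∃ μ : ℝ, ∀ j, (∑ l, a j l * t ^ (d l)) * ((∑ l, ((d l : ℝ) - d l₀) ^ 2 * a j l * t ^ (d l)) - μ * (∑ l, ((d l : ℝ) - d l₀) * a j l * t ^ (d l))) ≤ 0 ∧ (∑ l, ((d l : ℝ) - d l₀) * a j l * t ^ (d l)) ≠ 0) :
    ((∑ j, (∑ l, C (a j l * ((d l : ℝ) - d l₀)) * X ^ (d l)) * ∏ i ∈ Finset.univ.erase j, (∑ l, C (a i l) * X ^ (d l)) : ℝ[X]).roots.toFinset.filter (fun t => u ≤ t ∧ t ≤ v)).card ≤ 1 := by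
  rw [eulerNumerator_eq_general]
  have hP : ∀ t ∈ Set.Icc u v, (∏ j, ∑ l, C (a j l) * X ^ (d l) : ℝ[X]).eval t ≠ 0 := by
    intro t ht
    rw [eval_prod, Finset.prod_ne_zero_iff]
    intro j _
    rw [eval_fewnomial]
    exact hfree t ht j
  refine sepWeight_meanPivot_window_le_one (fun j => (∑ l, C (a j l) * X ^ (d l) : ℝ[X])) (d l₀ : ℝ) hu hP ?_
  intro t ht hEt
  have hEt' : (∑ j, (∑ l, C (a j l * ((d l : ℝ) - d l₀)) * X ^ (d l)) * ∏ i ∈ Finset.univ.erase j, (∑ l, C (a i l) * X ^ (d l)) : ℝ[X]).eval t = 0 := by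
    rw [eulerNumerator_eq_general]
    exact hEt
  obtain ⟨μ, hrow⟩ := hpiv t ht hEt'
  refine ⟨μ, fun j => ?_⟩
  rw [sepWeight_eval_shiftedTheta_sq, sepWeight_eval_shiftedTheta, eval_fewnomial]
  exact hrow j

/-- ★★★ **THE MEAN-ORDERED WINDOW LAW, EVERY `K`** (bottom coupling `d l₀ < d l` for `l ≠ l₀`, some `l ≠ l₀`; each row upper-signed against
the coupled letter or one-signed): on a pole-free window `[u,v] ⊂ (0,∞)` on which, at every point, every one-signed row and every switched
upper-signed row `j` (`f_j < 0`) has `B⁽²⁾_j/B_j ≤ B⁽²⁾_i/B_i` against every unswitched upper-signed row `i` (`f_i > 0`), `eulerNumerator d a l₀`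
has at most ONE root in `[u,v]`. [this file's theorem] -/
theorem sepWeight_meanOrdered_window_le_one {m K : ℕ} (d : Fin K → ℕ) (a : Fin m → Fin K → ℝ) (l₀ : Fin K)
    (hd : ∀ l, l ≠ l₀ → d l₀ < d l) (hK : ∃ l : Fin K, l ≠ l₀)
    (hrows : ∀ j, (0 < a j l₀ ∧ ∀ l, l ≠ l₀ → a j l < 0) ∨ (∀ l, 0 < a j l))
    {u v : ℝ} (hu : 0 < u) (hfree : ∀ t ∈ Set.Icc u v, ∀ j, (∑ l, a j l * t ^ (d l)) ≠ 0)
    (hord : ∀ t ∈ Set.Icc u v, ∀ j i,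
      ((∀ l, 0 < a j l) ∨ (∑ l, a j l * t ^ (d l)) < 0) → (∀ l, l ≠ l₀ → a i l < 0) → 0 < (∑ l, a i l * t ^ (d l)) → (∑ l, ((d l : ℝ) - d l₀) ^ 2 * a j l * t ^ (d l)) / (∑ l, ((d l : ℝ) - d l₀) * a j l * t ^ (d l)) ≤ (∑ l, ((d l : ℝ) - d l₀) ^ 2 * a i l * t ^ (d l)) / (∑ l, ((d l : ℝ) - d l₀) * a i l * t ^ (d l))) :
    ((∑ j, (∑ l, C (a j l * ((d l : ℝ) - d l₀)) * X ^ (d l)) * ∏ i ∈ Finset.univ.erase j, (∑ l, C (a i l) * X ^ (d l)) : ℝ[X]).roots.toFinset.filter (fun t => u ≤ t ∧ t ≤ v)).card ≤ 1 := by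
  classical
  refine sepWeight_meanPivot_eulerNumerator_window_le_one d a l₀ hu hfree (fun t ht _hEt => ?_)
  have hz : 0 < t := hu.trans_le ht.1
  have hg := hfree t ht
  have hBneg : ∀ j, (0 < a j l₀ ∧ ∀ l, l ≠ l₀ → a j l < 0) → (∑ l, ((d l : ℝ) - d l₀) * a j l * t ^ (d l)) < 0 := fun j h =>
    sepWeight_strippedRow_neg d (fun (_ : Fin 1) => a j) l₀ hd hK (fun _ => h) 0 hz
  have hBpos : ∀ j, (∀ l, 0 < a j l) → 0 < (∑ l, ((d l : ℝ) - d l₀) * a j l * t ^ (d l)) := fun j h =>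
    sepWeight_strippedRow_pos d (fun (_ : Fin 1) => a j) l₀ hd hK 0 h hz
  have hBne : ∀ j, (∑ l, ((d l : ℝ) - d l₀) * a j l * t ^ (d l)) ≠ 0 := by
    intro j
    rcases hrows j with h | h
    · exact (hBneg j h).ne
    · exact (hBpos j h).ne'
  have hGpos : ∀ j, (∀ l, 0 < a j l) → 0 < (∑ l, a j l * t ^ (d l)) := fun j h =>
    Finset.sum_pos (fun l _ => by have := h l; positivity) ⟨l₀, Finset.mem_univ _⟩
  set R : Finset (Fin m) := Finset.univ.filter (fun j => (∀ l, 0 < a j l) ∨ (∑ l, a j l * t ^ (d l)) < 0) with hR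
  by_cases hRne : R.Nonempty
  · obtain ⟨j₀, hj₀, hmax⟩ := R.exists_max_image (fun j => (∑ l, ((d l : ℝ) - d l₀) ^ 2 * a j l * t ^ (d l)) / (∑ l, ((d l : ℝ) - d l₀) * a j l * t ^ (d l))) hRne
    have hj₀' : (∀ l, 0 < a j₀ l) ∨ (∑ l, a j₀ l * t ^ (d l)) < 0 := (Finset.mem_filter.mp hj₀).2
    refine ⟨(∑ l, ((d l : ℝ) - d l₀) ^ 2 * a j₀ l * t ^ (d l)) / (∑ l, ((d l : ℝ) - d l₀) * a j₀ l * t ^ (d l)), fun j => ⟨?_, hBne j⟩⟩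
    rcases hrows j with h | h
    · have hBj := hBneg j h
      rcases lt_or_gt_of_ne (hg j) with hlt | hgt
      · have hle : (∑ l, ((d l : ℝ) - d l₀) ^ 2 * a j l * t ^ (d l)) / (∑ l, ((d l : ℝ) - d l₀) * a j l * t ^ (d l)) ≤ (∑ l, ((d l : ℝ) - d l₀) ^ 2 * a j₀ l * t ^ (d l)) / (∑ l, ((d l : ℝ) - d l₀) * a j₀ l * t ^ (d l)) := hmax j (Finset.mem_filter.mpr ⟨Finset.mem_univ _, Or.inr hlt⟩)
        have h1 : (∑ l, ((d l : ℝ) - d l₀) ^ 2 * a j₀ l * t ^ (d l)) / (∑ l, ((d l : ℝ) - d l₀) * a j₀ l * t ^ (d l)) * (∑ l, ((d l : ℝ) - d l₀) * a j l * t ^ (d l)) ≤ (∑ l, ((d l : ℝ) - d l₀) ^ 2 * a j l * t ^ (d l)) := (div_le_iff_of_neg hBj).mp hle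
        nlinarith
      · have hle : (∑ l, ((d l : ℝ) - d l₀) ^ 2 * a j₀ l * t ^ (d l)) / (∑ l, ((d l : ℝ) - d l₀) * a j₀ l * t ^ (d l)) ≤ (∑ l, ((d l : ℝ) - d l₀) ^ 2 * a j l * t ^ (d l)) / (∑ l, ((d l : ℝ) - d l₀) * a j l * t ^ (d l)) := hord t ht j₀ j hj₀' h.2 hgt
        have h1 : (∑ l, ((d l : ℝ) - d l₀) ^ 2 * a j l * t ^ (d l)) ≤ (∑ l, ((d l : ℝ) - d l₀) ^ 2 * a j₀ l * t ^ (d l)) / (∑ l, ((d l : ℝ) - d l₀) * a j₀ l * t ^ (d l)) * (∑ l, ((d l : ℝ) - d l₀) * a j l * t ^ (d l)) := (le_div_iff_of_neg hBj).mp hle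
        nlinarith
    · have hBj := hBpos j h
      have hGj := hGpos j h
      have hle : (∑ l, ((d l : ℝ) - d l₀) ^ 2 * a j l * t ^ (d l)) / (∑ l, ((d l : ℝ) - d l₀) * a j l * t ^ (d l)) ≤ (∑ l, ((d l : ℝ) - d l₀) ^ 2 * a j₀ l * t ^ (d l)) / (∑ l, ((d l : ℝ) - d l₀) * a j₀ l * t ^ (d l)) := hmax j (Finset.mem_filter.mpr ⟨Finset.mem_univ _, Or.inl h⟩)
      have h1 : (∑ l, ((d l : ℝ) - d l₀) ^ 2 * a j l * t ^ (d l)) ≤ (∑ l, ((d l : ℝ) - d l₀) ^ 2 * a j₀ l * t ^ (d l)) / (∑ l, ((d l : ℝ) - d l₀) * a j₀ l * t ^ (d l)) * (∑ l, ((d l : ℝ) - d l₀) * a j l * t ^ (d l)) := (div_le_iff₀ hBj).mp hle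
      nlinarith
  · rcases Nat.eq_zero_or_pos m with hm | hm
    · subst hm
      exact ⟨0, fun j => j.elim0⟩
    obtain ⟨j₁, -, hmin⟩ := Finset.univ.exists_min_image (fun j => (∑ l, ((d l : ℝ) - d l₀) ^ 2 * a j l * t ^ (d l)) / (∑ l, ((d l : ℝ) - d l₀) * a j l * t ^ (d l))) ⟨⟨0, hm⟩, Finset.mem_univ _⟩
    refine ⟨(∑ l, ((d l : ℝ) - d l₀) ^ 2 * a j₁ l * t ^ (d l)) / (∑ l, ((d l : ℝ) - d l₀) * a j₁ l * t ^ (d l)), fun j => ⟨?_, hBne j⟩⟩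
    have hnot : ¬ ((∀ l, 0 < a j l) ∨ (∑ l, a j l * t ^ (d l)) < 0) := fun h => hRne ⟨j, Finset.mem_filter.mpr ⟨Finset.mem_univ _, h⟩⟩
    have h : 0 < a j l₀ ∧ ∀ l, l ≠ l₀ → a j l < 0 := by
      rcases hrows j with h | h
      · exact h
      · exact absurd (Or.inl h) hnot
    have hBj := hBneg j h
    have hgt : 0 < (∑ l, a j l * t ^ (d l)) := by
      rcases lt_or_gt_of_ne (hg j) with hlt | hgt
      · exact absurd (Or.inr hlt) hnot
      · exact hgt
    have hle : (∑ l, ((d l : ℝ) - d l₀) ^ 2 * a j₁ l * t ^ (d l)) / (∑ l, ((d l : ℝ) - d l₀) * a j₁ l * t ^ (d l)) ≤ (∑ l, ((d l : ℝ) - d l₀) ^ 2 * a j l * t ^ (d l)) / (∑ l, ((d l : ℝ) - d l₀) * a j l * t ^ (d l)) := hmin j (Finset.mem_univ _)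
    have h1 : (∑ l, ((d l : ℝ) - d l₀) ^ 2 * a j l * t ^ (d l)) ≤ (∑ l, ((d l : ℝ) - d l₀) ^ 2 * a j₁ l * t ^ (d l)) / (∑ l, ((d l : ℝ) - d l₀) * a j₁ l * t ^ (d l)) * (∑ l, ((d l : ℝ) - d l₀) * a j l * t ^ (d l)) := (le_div_iff_of_neg hBj).mp hle
    nlinarith

end ProductPlusOne

end Summit.ValiantsHypothesis.ValiantsHypothesis.Theorems.LacunarySymmetroidMatrixDescartes
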